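import Summits.QuantumFields.YangMills.Theorems.GronwallGapContinuumFromLatticeGapOneFieldUniform
import Summits.QuantumFields.YangMills.Theorems.GronwallGapContinuumFromLatticeGapDockSWS
import Summits.QuantumFields.YangMills.Theorems.GronwallGapContinuumFromLatticeGapStubMonomialConstants
import Summits.QuantumFields.YangMills.Theorems.GronwallGapContinuumFromLatticeGapStubVolumeChoice
import HarnessLib

/-!
# `ContinuumFromLatticeGap` (stmt-QuantumFields-15915), line `registered`, reshape 6: the dock over the UNIFORM-monomial
# hypotheses (`stub_clayOfUniformInequalities`) and the def-free reshape-6 compositions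

Support file for the crux item stmt-QuantumFields-15915 (`GronwallGap.ContinuumFromLatticeGap`), reshape 6 of line
`registered`: W₁'s RP-spectral conjunct (b) is ELIMINATED from the line.  The dock anchor `stub_clayOfUniformInequalities` is
the twin of the landed `stub_clayOfLocalInequalities` (p161399) with the LOCAL RP-spectral clause replaced by ONE clustering
constant `Cmono n d ≥ 1` per (arity, box) for the reflected diagonal pairs of plaquette monomials along the scheme (rate
`Δ a_k`) and its absorption by the volumes; its proof is the seam `oneField_of_latticeInequalities_uniform` (whose decay leg is
`stub_decayOfUniformMonomials`: torus RP chord + Minkowski + dictionary), `hypercubicAt_of_oneField`, `concl_of_hypercubicAt`.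

The def-free compositions `continuumFromLatticeGap_of_uniform` (THIS crux) and `continuumLegGivenGap_of_uniform` (the sibling
crux stmt-QuantumFields-15828) close the two cruxes from `XiDiverges`, the ONE-SCALE stub with cofinal volumes, U_R, W₂ᴳ and
orientation amnesia BY NAME: the lock gives UNIFORM; `stub_monomialConstants` turns UNIFORM into one constant per (arity, box);
`stub_volumeChoice` gives the absorbing volume floor, which ONE SCALE may exceed because it chooses the volumes.  Refs:
GlimmJaffe1987 §6.1, §19.1; OsterwalderSeiler1978 §§2–3.
-/

noncomputable section

namespace Summit.QuantumFields.YangMills.Theorems.ContinuumFromLatticeGap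

open scoped SchwartzMap
open Filter Topology MeasureTheory
open Literature.MathematicalPhysics.QuantumFieldTheory Literature.MathematicalPhysics.QuantumLattice
  Literature.MathematicalPhysics.AQFT Literature.Probability.LatticeModels
open Summit.QuantumFields.YangMills.Theses
open Summit.QuantumFields.YangMills.Theorems.ContinuumLegGivenGap
open Summit.QuantumFields.YangMills.Cruxes.HypercubicLimit.CouplingResponse (OneFieldClauses)
open Summit.QuantumFields.YangMills.Cruxes.OSLegsFromFemtoAndGap.DlrCollarTransfer (plane)

/-! ## The dock anchor -/

/-- **`stub_clayOfUniformInequalities`** (registered anchor of line `registered`, reshape 6 — the dock's core over the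
UNIFORM-monomial hypotheses, general Borel measurable structure, `let`-free): **the Clay `G`-clause from the lattice
inequalities at ONE witness** — a weak-coupling scheme with polynomial volumes, the uniform lattice gap at rate `Δ`, ONE
clustering constant per (arity, box) for the reflected diagonal monomial pairs on the scheme's tori at rate `Δ a_k`, volumes
absorbing these constants, a past-supported bump with the polynomial floor and the window of the bare truncated two-point
function `T`, plus U_R, W₂ᴳ (fed the same gap) and orientation amnesia by name.  Proof: the measurable structure IS `borel G`,
`T` IS the bare truncated two-point function; the seam `oneField_of_latticeInequalities_uniform`; `hypercubicAt_of_oneField`;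
`concl_of_hypercubicAt`. [cite: GlimmJaffe1987, §6.1 and §19.1] -/
theorem stub_clayOfUniformInequalities :
    ∀ (G : Type) [Group G] [TopologicalSpace G] [IsTopologicalGroup G] [CompactSpace G] [MeasurableSpace G]
      [BorelSpace G], IsCompactSimpleLieGroup G → ScalingWindowSplit.SelfNormalisedMomentBoundsR →
      ScalingWindowSplit.SelfNormalisedSkewnessGapped → CoincidenceRotationBootstrap.CurvatureAmnesia →
      ∀ (r : LatticeRep G) (sch : SpeciesScheme (YMSpecies G)) (u : 𝓢(EuclideanSpace ℝ (Fin 4), ℝ)) (p : ℕ) (M Δ : ℝ)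
      (Cmono : ℕ → ℕ → ℝ) (T : 𝓢(EuclideanSpace ℝ (Fin 4), ℝ) → ℕ → ℝ),
      (∀ w k, T w k = latticeSchwinger r.ρ (SpeciesScheme.mk sch.a sch.a_pos sch.tendsto_a sch.β sch.L sch.tendsto_L (fun _ _ => 1) (fun _ _ => 0))
          (fun s => s.F) k (1 + 1) (fun _ => r.curvature) ![w, thetaTest 4 w] -
        latticeSchwinger r.ρ (SpeciesScheme.mk sch.a sch.a_pos sch.tendsto_a sch.β sch.L sch.tendsto_L (fun _ _ => 1) (fun _ _ => 0))
          (fun s => s.F) k 1 (fun _ => r.curvature) ![w] *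
        latticeSchwinger r.ρ (SpeciesScheme.mk sch.a sch.a_pos sch.tendsto_a sch.β sch.L sch.tendsto_L (fun _ _ => 1) (fun _ _ => 0))
          (fun s => s.F) k 1 (fun _ => r.curvature) ![thetaTest 4 w]) →
      sch.HasWeakCouplingLimit → (∃ N : ℕ, 1 ≤ N ∧ ∀ᶠ k in atTop, (sch.a k)⁻¹ ≤ (sch.a k * (sch.L k : ℝ)) ^ N) →
      0 < Δ → HasLatticeMassGap r sch Δ → (∀ n d, 1 ≤ Cmono n d) →
      (∀ (n d : ℕ) (q : Fin n → Fin 4 × Fin 4) (y : Fin n → Site 4),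
        (∀ l, (0 ≤ y l 0 ∧ y l 0 ≤ (d : ℤ)) ∧ ∀ i : Fin 4, i ≠ 0 → |y l i| ≤ (d : ℤ)) →
        ∀ (s : Finset (Fin n)) (k j : ℕ), j ≤ sch.L k →
          latticeConnectedCorr r.ρ (sch.β k) (2 * sch.L k + 1)
              ((fun V => ∏ l ∈ s, plane G r (q l) (y l) V) ∘ gaugeTimeReflect)
              (fun V => ∏ l ∈ s, plane G r (q l) (y l) V) j ≤ Cmono n d * Real.exp (-(Δ * sch.a k * j))) →
      (∀ n ρ : ℕ, Tendsto (fun k => (Real.log (Cmono n (⌊(ρ : ℝ) / sch.a k⌋₊ + 2)) + |Real.log (sch.a k)|) /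
          (sch.a k * (sch.L k : ℝ))) atTop (𝓝 0)) →
      tsupport u ⊆ {y : EuclideanSpace ℝ (Fin 4) | y 0 < 0} →
      (∀ᶠ k in atTop, (sch.a k) ^ p ≤ T u k ∧ T u k ≤ M * T (timeShiftTest 4 (-1) u) k) →
      ∃ (r : LatticeRep G) (sch : SpeciesScheme (YMSpecies G)) (T : OSData (YMSpecies G) 4),
        sch.HasWeakCouplingLimit ∧ IsYangMillsFor r sch T ∧ T.IsNontrivial r.curvature ∧
          T.IsNonGaussian r.curvature ∧ ∃ Δ > 0, T.HasMassGap Δ ∧ HasLatticeMassGap r sch Δ := by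
  intro G _ _ _ _ _ _ hG hU hW₂ hA r sch u p M Δ Cmono T hT hw hpv hΔ hGAP hC1 hmono habs hu hfw
  obtain rfl : T = fun w k => latticeSchwinger r.ρ (SpeciesScheme.mk sch.a sch.a_pos sch.tendsto_a sch.β sch.L sch.tendsto_L (fun _ _ => 1) (fun _ _ => 0))
          (fun s => s.F) k (1 + 1) (fun _ => r.curvature) ![w, thetaTest 4 w] -
        latticeSchwinger r.ρ (SpeciesScheme.mk sch.a sch.a_pos sch.tendsto_a sch.β sch.L sch.tendsto_L (fun _ _ => 1) (fun _ _ => 0))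
          (fun s => s.F) k 1 (fun _ => r.curvature) ![w] *
        latticeSchwinger r.ρ (SpeciesScheme.mk sch.a sch.a_pos sch.tendsto_a sch.β sch.L sch.tendsto_L (fun _ _ => 1) (fun _ _ => 0))
          (fun s => s.F) k 1 (fun _ => r.curvature) ![thetaTest 4 w] := funext fun w => funext fun k => hT w k
  have hm : ‹MeasurableSpace G› = borel G := BorelSpace.measurable_eq
  subst hm
  letI : MeasurableSpace G := borel G
  haveI : BorelSpace G := ⟨rfl⟩
  obtain ⟨sch', S₁', hw', h₁⟩ :=
    oneField_of_latticeInequalities_uniform r sch u p M Δ Cmono hw hpv hΔ hGAP hC1 hmono habs hu hfw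
      (hU G r sch u p M hw hpv hu hfw) (hW₂ G r sch u p M Δ hw hΔ hGAP hpv hu hfw)
  exact concl_of_hypercubicAt hA hG (hypercubicAt_of_oneField r sch' S₁' hw' h₁)

/-! ## The def-free reshape-6 compositions -/

section Compositions

/-- **The common core of the two compositions**: at a compact simple `G` (Borel σ-algebra), a faithful `r` and a locked
critical datum (`β_k → ∞`, rates `m̂_k`, UNIFORM with thresholds `S₁`, `m̂ → 0`) with ONE-SCALE data at it admitting COFINAL
volumes (unit `Δ₀ a_k ≤ m̂(φ k)`; for every volume floor some volumes above it, `≥ S₁(φ k)`, of polynomial growth, with a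
past-supported bump and floor ∧ window for every scheme on `(a, β ∘ φ, L)`), U_R, W₂ᴳ and amnesia by name give the Clay
`G`-clause: UNIFORM ⇒ monomial constants (`stub_monomialConstants`); the absorbing volume floor (`stub_volumeChoice`); the bare
scheme on the data (`stub_bareScheme`) carries the lattice gap (`cclgSplit_gap_of_locked`) and the monomial bounds at rate
`Δ₀ a_k`; then `stub_clayOfUniformInequalities`. [cite: GlimmJaffe1987, §6.1 and §19.1] -/
theorem concl_of_lockedDatum_uniform {G : Type} [Group G] [TopologicalSpace G] [IsTopologicalGroup G] [CompactSpace G]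
    (hG : IsCompactSimpleLieGroup G)
    (hU : ScalingWindowSplit.SelfNormalisedMomentBoundsR) (hW₂ : ScalingWindowSplit.SelfNormalisedSkewnessGapped)
    (hA : CoincidenceRotationBootstrap.CurvatureAmnesia)
    (r : letI : MeasurableSpace G := borel G; LatticeRep G) (β mh : ℕ → ℝ) (S₁ : ℕ → ℕ)
    (hβ : Tendsto β atTop atTop)
    (hUNIF : letI : MeasurableSpace G := borel G; haveI : BorelSpace G := ⟨rfl⟩;
      ∀ A B : YMSpecies G, ∃ C : ℝ, ∀ k S n : ℕ, S₁ k ≤ S → n ≤ S →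
        |latticeConnectedCorr r.ρ (β k) (2 * S + 1) A.F B.F n| ≤ C * Real.exp (-(mh k * n)))
    (hcrit : Tendsto mh atTop (𝓝 0)) (a : ℕ → ℝ) (φ : ℕ → ℕ) (Δ₀ : ℝ)
    (ha : ∀ k, 0 < a k) (hφ : StrictMono φ) (hΔ₀ : 0 < Δ₀) (hpin : ∀ k, Δ₀ * a k ≤ mh (φ k))
    (hcof : letI : MeasurableSpace G := borel G; haveI : BorelSpace G := ⟨rfl⟩;
      ∀ L₀ : ℕ → ℕ, ∃ (L : ℕ → ℕ) (u : 𝓢(EuclideanSpace ℝ (Fin 4), ℝ)) (p : ℕ) (M : ℝ),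
        (∀ k, L₀ k ≤ L k) ∧ (∀ k, S₁ (φ k) ≤ L k) ∧
        (∃ N : ℕ, 1 ≤ N ∧ ∀ᶠ k in atTop, (a k)⁻¹ ≤ (a k * (L k : ℝ)) ^ N) ∧
        tsupport u ⊆ {y : EuclideanSpace ℝ (Fin 4) | y 0 < 0} ∧
        ∀ sch : SpeciesScheme (YMSpecies G), (∀ k, sch.a k = a k) → (∀ k, sch.β k = β (φ k)) →
          (∀ k, sch.L k = L k) → ∀ T : 𝓢(EuclideanSpace ℝ (Fin 4), ℝ) → ℕ → ℝ,
          (∀ w k, T w k =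
            latticeSchwinger r.ρ (SpeciesScheme.mk sch.a sch.a_pos sch.tendsto_a sch.β sch.L sch.tendsto_L
              (fun _ _ => 1) (fun _ _ => 0)) (fun s => s.F) k (1 + 1) (fun _ => r.curvature) ![w, thetaTest 4 w] -
            latticeSchwinger r.ρ (SpeciesScheme.mk sch.a sch.a_pos sch.tendsto_a sch.β sch.L sch.tendsto_L
              (fun _ _ => 1) (fun _ _ => 0)) (fun s => s.F) k 1 (fun _ => r.curvature) ![w] *
            latticeSchwinger r.ρ (SpeciesScheme.mk sch.a sch.a_pos sch.tendsto_a sch.β sch.L sch.tendsto_L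
              (fun _ _ => 1) (fun _ _ => 0)) (fun s => s.F) k 1 (fun _ => r.curvature) ![thetaTest 4 w]) →
          ∀ᶠ k in atTop, (sch.a k) ^ p ≤ T u k ∧ T u k ≤ M * T (timeShiftTest 4 (-1) u) k) :
    letI : MeasurableSpace G := borel G
    haveI : BorelSpace G := ⟨rfl⟩
    ∃ (r : LatticeRep G) (sch : SpeciesScheme (YMSpecies G)) (T : OSData (YMSpecies G) 4),
      sch.HasWeakCouplingLimit ∧ IsYangMillsFor r sch T ∧ T.IsNontrivial r.curvature ∧
        T.IsNonGaussian r.curvature ∧ ∃ Δ > 0, T.HasMassGap Δ ∧ HasLatticeMassGap r sch Δ := by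
  letI : MeasurableSpace G := borel G
  haveI : BorelSpace G := ⟨rfl⟩
  -- ONE constant per (arity, box) from UNIFORM
  obtain ⟨Cmono, hC1, hCmono⟩ := stub_monomialConstants G r β mh S₁ hUNIF
  -- the absorbing volume floor and volumes above it
  have ha0 : Tendsto a atTop (𝓝 0) := stub_unitToZero a mh φ Δ₀ ha hφ hΔ₀ hpin hcrit
  obtain ⟨L₀, hL₀⟩ := stub_volumeChoice a (fun k => S₁ (φ k)) Cmono ha ha0
  obtain ⟨L, u, p, M, hLL₀, hLS, ⟨N, hN1, hpolyN⟩, hu, hfw⟩ := hcof L₀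
  obtain ⟨-, -, habsL⟩ := hL₀ L hLL₀
  -- the bare scheme on the locked data
  have hLt : Tendsto (fun k => a k * (L k : ℝ)) atTop atTop := cscl_tendsto_mul_of_pow hN1 ha ha0 hpolyN
  obtain ⟨sch, hsa, hsβ, hsL, -, -⟩ := stub_bareScheme G a (fun k => β (φ k)) L ha ha0 hLt
  have hw : sch.HasWeakCouplingLimit := by
    show Tendsto sch.β atTop atTop
    rw [show sch.β = fun k => β (φ k) from funext hsβ]
    exact hβ.comp hφ.tendsto_atTop
  have hpv : ∃ N : ℕ, 1 ≤ N ∧ ∀ᶠ k in atTop, (sch.a k)⁻¹ ≤ (sch.a k * (sch.L k : ℝ)) ^ N :=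
    ⟨N, hN1, hpolyN.mono fun k hk => by rw [hsa k, hsL k]; exact hk⟩
  have hpin' : ∀ k, Δ₀ * sch.a k ≤ mh (φ k) := fun k => by rw [hsa k]; exact hpin k
  have hLS' : ∀ k, S₁ (φ k) ≤ sch.L k := fun k => by rw [hsL k]; exact hLS k
  -- the lattice gap along the scheme and the monomial bounds at rate `Δ₀ a_k`
  have hGAP₀ : HasLatticeMassGap r sch Δ₀ := cclgSplit_gap_of_locked r hUNIF hsβ hpin' hLS'
  have hC0 : ∀ n d, 0 ≤ Cmono n d := fun n d => zero_le_one.trans (hC1 n d)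
  have hmonoS : ∀ (n d : ℕ) (q : Fin n → Fin 4 × Fin 4) (y : Fin n → Site 4),
      (∀ l, (0 ≤ y l 0 ∧ y l 0 ≤ (d : ℤ)) ∧ ∀ i : Fin 4, i ≠ 0 → |y l i| ≤ (d : ℤ)) →
      ∀ (s : Finset (Fin n)) (k j : ℕ), j ≤ sch.L k →
        latticeConnectedCorr r.ρ (sch.β k) (2 * sch.L k + 1)
            ((fun V => ∏ l ∈ s, plane G r (q l) (y l) V) ∘ gaugeTimeReflect)
            (fun V => ∏ l ∈ s, plane G r (q l) (y l) V) j ≤ Cmono n d * Real.exp (-(Δ₀ * sch.a k * j)) := by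
    intro n d q y hy s k j hj
    have h := hCmono n d q y hy s (φ k) (sch.L k) j (hLS' k) hj
    rw [hsβ k]
    refine (le_abs_self _).trans (h.trans ?_)
    refine mul_le_mul_of_nonneg_left (Real.exp_le_exp.2 ?_) (hC0 n d)
    have hj0 : (0 : ℝ) ≤ j := Nat.cast_nonneg j
    nlinarith [hpin' k, hj0]
  have habsS : ∀ n ρ : ℕ, Tendsto (fun k => (Real.log (Cmono n (⌊(ρ : ℝ) / sch.a k⌋₊ + 2)) +
      |Real.log (sch.a k)|) / (sch.a k * (sch.L k : ℝ))) atTop (𝓝 0) := by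
    intro n ρ
    refine (habsL n ρ).congr fun k => ?_
    rw [hsa k, hsL k, max_eq_right (hC1 _ _)]
  -- floor ∧ window at our scheme, then the dock anchor
  have hfw' := hfw sch hsa hsβ hsL _ (fun _ _ => rfl)
  exact stub_clayOfUniformInequalities G hG hU hW₂ hA r sch u p M Δ₀ Cmono _ (fun _ _ => rfl) hw hpv hΔ₀ hGAP₀ hC1
    hmonoS habsS hu hfw'

/-- **`continuumFromLatticeGap_of_uniform`** — the def-free RESHAPE-6 split of the crux stmt-QuantumFields-15915:
`XiDiverges → ⟨stub_oneScaleCofinal⟩ → SelfNormalisedMomentBoundsR → SelfNormalisedSkewnessGapped → CurvatureAmnesia →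
GronwallGap.ContinuumFromLatticeGap`.  W₁'s RP-spectral conjunct (b) no longer appears: ONE SCALE (floor ∧ window of the bare
plaquette two-point function at the locked unit, cofinal volumes) is the only open input besides the filed items.  One scale
chooses `r`; the landed lock OFF the exceptional set (`stub_lockOffE`) and criticality (`stub_criticalOfLock`) give the locked
critical datum; then `concl_of_lockedDatum_uniform`. [cite: GlimmJaffe1987, §6.1 and §19.1] -/
theorem continuumFromLatticeGap_of_uniform (hXi : DirichletWindow.XiDiverges)
    (hOne : ∀ (G : Type) [Group G] [TopologicalSpace G] [IsTopologicalGroup G] [CompactSpace G]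
      [MeasurableSpace G] [BorelSpace G], IsCompactSimpleLieGroup G → ∃ r : LatticeRep G,
      ∀ (β : ℕ → ℝ) (mh : ℕ → ℝ) (S₁ : ℕ → ℕ) (K : ℝ), Tendsto β atTop atTop → (∀ k, 0 < mh k) → 0 < K →
      (∀ A B : YMSpecies G, ∃ C : ℝ, ∀ k S n : ℕ, S₁ k ≤ S → n ≤ S →
        |latticeConnectedCorr r.ρ (β k) (2 * S + 1) A.F B.F n| ≤ C * Real.exp (-(mh k * n))) →
      (∀ k S₀ : ℕ, ∃ A B : YMSpecies G, ∀ C : ℝ, ∃ S n : ℕ, S₀ ≤ S ∧ n ≤ S ∧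
        C * Real.exp (-(K * mh k * n)) < |latticeConnectedCorr r.ρ (β k) (2 * S + 1) A.F B.F n|) →
      Tendsto mh atTop (𝓝 0) →
      ∃ (a : ℕ → ℝ) (φ : ℕ → ℕ) (Δ₀ : ℝ), (∀ k, 0 < a k) ∧ StrictMono φ ∧ 0 < Δ₀ ∧ (∀ k, Δ₀ * a k ≤ mh (φ k)) ∧
        ∀ L₀ : ℕ → ℕ, ∃ (L : ℕ → ℕ) (u : 𝓢(EuclideanSpace ℝ (Fin 4), ℝ)) (p : ℕ) (M : ℝ),
          (∀ k, L₀ k ≤ L k) ∧ (∀ k, S₁ (φ k) ≤ L k) ∧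
          (∃ N : ℕ, 1 ≤ N ∧ ∀ᶠ k in atTop, (a k)⁻¹ ≤ (a k * (L k : ℝ)) ^ N) ∧
          tsupport u ⊆ {y : EuclideanSpace ℝ (Fin 4) | y 0 < 0} ∧
          ∀ sch : SpeciesScheme (YMSpecies G), (∀ k, sch.a k = a k) → (∀ k, sch.β k = β (φ k)) →
            (∀ k, sch.L k = L k) → ∀ T : 𝓢(EuclideanSpace ℝ (Fin 4), ℝ) → ℕ → ℝ,
            (∀ w k, T w k =
              latticeSchwinger r.ρ (SpeciesScheme.mk sch.a sch.a_pos sch.tendsto_a sch.β sch.L sch.tendsto_L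
                (fun _ _ => 1) (fun _ _ => 0)) (fun s => s.F) k (1 + 1) (fun _ => r.curvature) ![w, thetaTest 4 w] -
              latticeSchwinger r.ρ (SpeciesScheme.mk sch.a sch.a_pos sch.tendsto_a sch.β sch.L sch.tendsto_L
                (fun _ _ => 1) (fun _ _ => 0)) (fun s => s.F) k 1 (fun _ => r.curvature) ![w] *
              latticeSchwinger r.ρ (SpeciesScheme.mk sch.a sch.a_pos sch.tendsto_a sch.β sch.L sch.tendsto_L
                (fun _ _ => 1) (fun _ _ => 0)) (fun s => s.F) k 1 (fun _ => r.curvature) ![thetaTest 4 w]) →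
            ∀ᶠ k in atTop, (sch.a k) ^ p ≤ T u k ∧ T u k ≤ M * T (timeShiftTest 4 (-1) u) k)
    (hU : ScalingWindowSplit.SelfNormalisedMomentBoundsR) (hW₂ : ScalingWindowSplit.SelfNormalisedSkewnessGapped)
    (hA : CoincidenceRotationBootstrap.CurvatureAmnesia) :
    GronwallGap.ContinuumFromLatticeGap := by
  intro G _ _ _ _ hG hgap
  letI : MeasurableSpace G := borel G
  haveI : BorelSpace G := ⟨rfl⟩
  obtain ⟨r, hone⟩ := hOne G hG
  obtain ⟨β, mh, S₁, K, hβ, hmh, hK, hUNIF, hSHARP⟩ := stub_lockOffE hXi G hG r (hgap r)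
  have hcrit : Tendsto mh atTop (𝓝 0) := stub_criticalOfLock hXi G hG r β mh S₁ hβ hmh hUNIF
  obtain ⟨a, φ, Δ₀, ha, hφ, hΔ₀, hpin, hcof⟩ := hone β mh S₁ K hβ hmh hK hUNIF hSHARP hcrit
  exact concl_of_lockedDatum_uniform hG hU hW₂ hA r β mh S₁ hβ hUNIF hcrit a φ Δ₀ ha hφ hΔ₀ hpin hcof

/-- **`continuumLegGivenGap_of_uniform`** — the SAME reshape-6 dock closes the sibling crux stmt-QuantumFields-15828
`ContinuumLegGivenGap` (hypothesis: gap at every `β ≥ β₀` with a pair-free threshold): the locked datum is the landed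
`cclgSplit_locked_of_core`, criticality is again `stub_criticalOfLock`; then `concl_of_lockedDatum_uniform`.  Stated for route
`ComplexCouplingChannel`'s copy of the shared decl. [cite: GlimmJaffe1987, §6.1 and §19.1] -/
theorem continuumLegGivenGap_of_uniform (hXi : DirichletWindow.XiDiverges)
    (hOne : ∀ (G : Type) [Group G] [TopologicalSpace G] [IsTopologicalGroup G] [CompactSpace G]
      [MeasurableSpace G] [BorelSpace G], IsCompactSimpleLieGroup G → ∃ r : LatticeRep G,
      ∀ (β : ℕ → ℝ) (mh : ℕ → ℝ) (S₁ : ℕ → ℕ) (K : ℝ), Tendsto β atTop atTop → (∀ k, 0 < mh k) → 0 < K →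
      (∀ A B : YMSpecies G, ∃ C : ℝ, ∀ k S n : ℕ, S₁ k ≤ S → n ≤ S →
        |latticeConnectedCorr r.ρ (β k) (2 * S + 1) A.F B.F n| ≤ C * Real.exp (-(mh k * n))) →
      (∀ k S₀ : ℕ, ∃ A B : YMSpecies G, ∀ C : ℝ, ∃ S n : ℕ, S₀ ≤ S ∧ n ≤ S ∧
        C * Real.exp (-(K * mh k * n)) < |latticeConnectedCorr r.ρ (β k) (2 * S + 1) A.F B.F n|) →
      Tendsto mh atTop (𝓝 0) →
      ∃ (a : ℕ → ℝ) (φ : ℕ → ℕ) (Δ₀ : ℝ), (∀ k, 0 < a k) ∧ StrictMono φ ∧ 0 < Δ₀ ∧ (∀ k, Δ₀ * a k ≤ mh (φ k)) ∧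
        ∀ L₀ : ℕ → ℕ, ∃ (L : ℕ → ℕ) (u : 𝓢(EuclideanSpace ℝ (Fin 4), ℝ)) (p : ℕ) (M : ℝ),
          (∀ k, L₀ k ≤ L k) ∧ (∀ k, S₁ (φ k) ≤ L k) ∧
          (∃ N : ℕ, 1 ≤ N ∧ ∀ᶠ k in atTop, (a k)⁻¹ ≤ (a k * (L k : ℝ)) ^ N) ∧
          tsupport u ⊆ {y : EuclideanSpace ℝ (Fin 4) | y 0 < 0} ∧
          ∀ sch : SpeciesScheme (YMSpecies G), (∀ k, sch.a k = a k) → (∀ k, sch.β k = β (φ k)) →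
            (∀ k, sch.L k = L k) → ∀ T : 𝓢(EuclideanSpace ℝ (Fin 4), ℝ) → ℕ → ℝ,
            (∀ w k, T w k =
              latticeSchwinger r.ρ (SpeciesScheme.mk sch.a sch.a_pos sch.tendsto_a sch.β sch.L sch.tendsto_L
                (fun _ _ => 1) (fun _ _ => 0)) (fun s => s.F) k (1 + 1) (fun _ => r.curvature) ![w, thetaTest 4 w] -
              latticeSchwinger r.ρ (SpeciesScheme.mk sch.a sch.a_pos sch.tendsto_a sch.β sch.L sch.tendsto_L
                (fun _ _ => 1) (fun _ _ => 0)) (fun s => s.F) k 1 (fun _ => r.curvature) ![w] *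
              latticeSchwinger r.ρ (SpeciesScheme.mk sch.a sch.a_pos sch.tendsto_a sch.β sch.L sch.tendsto_L
                (fun _ _ => 1) (fun _ _ => 0)) (fun s => s.F) k 1 (fun _ => r.curvature) ![thetaTest 4 w]) →
            ∀ᶠ k in atTop, (sch.a k) ^ p ≤ T u k ∧ T u k ≤ M * T (timeShiftTest 4 (-1) u) k)
    (hU : ScalingWindowSplit.SelfNormalisedMomentBoundsR) (hW₂ : ScalingWindowSplit.SelfNormalisedSkewnessGapped)
    (hA : CoincidenceRotationBootstrap.CurvatureAmnesia) :
    ComplexCouplingChannel.ContinuumLegGivenGap := by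
  intro G _ _ _ _ hG hgap
  letI : MeasurableSpace G := borel G
  haveI : BorelSpace G := ⟨rfl⟩
  obtain ⟨r, hone⟩ := hOne G hG
  obtain ⟨β, mh, S₁, K, hβ, hmh, hK, hUNIF, hSHARP⟩ := cclgSplit_locked_of_core hXi hG r (hgap r)
  have hcrit : Tendsto mh atTop (𝓝 0) := stub_criticalOfLock hXi G hG r β mh S₁ hβ hmh hUNIF
  obtain ⟨a, φ, Δ₀, ha, hφ, hΔ₀, hpin, hcof⟩ := hone β mh S₁ K hβ hmh hK hUNIF hSHARP hcrit
  exact concl_of_lockedDatum_uniform hG hU hW₂ hA r β mh S₁ hβ hUNIF hcrit a φ Δ₀ ha hφ hΔ₀ hpin hcof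

end Compositions

end Summit.QuantumFields.YangMills.Theorems.ContinuumFromLatticeGap

end
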